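import Literature.NumberTheory.EllipticCurves.ComplexMultiplicationShaRubinInflationProofs
import HarnessLib

/-!
# Route `CMKolyvaginAtInertTwo`, crux `CMKolyvaginExactAtInertTwo` (stmt-BirchSwinnertonDyer-24277):
# INFLATION–RESTRICTION AT AN INDEX-TWO SUBGROUP — `H¹(⟨τ⟩, M) = 0` for the REGULAR `C₂`-module,
# the local input of T2 path (β) at an inert Kolyvagin prime (KERNEL-STATUS §14.3)

Seat `bsd-line-cmk2-p1` g15 (cell `bsd-print-cf2`); helper (`--supports stmt-BirchSwinnertonDyer-24277`).
THEOREMS ONLY (pure group cohomology in the tree's model `cocyclesVanishingOn` / `inflClass` /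
`resKer` of `Literature/…/ShaRestriction`): no definition, no named fact, no `sorry`; no item is
closed; BSD is not proved by this.

WHY. Path (β) of the T2 design (KERNEL-STATUS §13.9, §14.3) maps the `ℚ`-pair carrier into the
pair over `K` and needs the strict local conditions to correspond: `Sd.A ℓ = f⁻¹(pairA ℓ)`, i.e.
`ξ_ℓ = 0 in H¹(ℚ_ℓ, E[2^M]) ↔ (res ξ)_λ = 0 in H¹(K_λ, E[2^M])` at a Kolyvagin prime `ℓ` inert in
`K`. The forward direction is ty2 g22's `resTorsion_mem_torsionLocalKer_of_under`; the converse is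
injectivity of `H¹(ℚ_ℓ, E[2^M]) → H¹(K_λ, E[2^M])`, i.e. (inflation–restriction)
`H¹(Gal(K_λ/ℚ_ℓ), E[2^M]) = 0` with `Gal = ⟨Frob_ℓ⟩ ≅ C₂` acting through the transposition-type
involution `τ` and `Γ_{K_λ}` acting trivially (depth-`(M+1)` prime). The tree's vanishing criterion
for inflated classes is Sah's (`Rubin1987.inflClass_eq_zero_of_bijOn`: `g₀ − 1` bijective on `M^N`),
which fails for an involution with fixed points. This file supplies the INDEX-TWO criterion instead:
for `G = N ∪ τN`, `τ² ∈ N`, an inflated cocycle `f` has `m = f τ ∈ M^N` with `m + τm = 0`, and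
`f = ∂x` as soon as `m = τx − x` for some `x ∈ M^N`; for the REGULAR module (`M^N` spanned by `e`,
`τe` with `τ²e = e` and "`c•e + c•τe = 0 ⟹ c•e = 0`") every such `m` is of that form. Hence
`ker(res) = 0`.

* `exists_eq_smul_sub_of_index_two` — the index-two Sah substitute (crossed homomorphisms vanishing
  on `N` are principal when the `τ`-anti-invariants of `M^N` are `τ`-coboundaries);
* `inflClass_eq_zero_of_index_two`, `resKer_eq_bot_of_index_two` — inflated classes vanish;
  restriction along a compatible pair `(θ, ψ)` with `N ≤ θ(H)` is injective;
* `exists_smul_sub_eq_of_regular` — the solvability `m + τm = 0 ⟹ ∃ x, τx − x = m` for the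
  regular `C₂`-module (`m = a•e + b•τe`).

References: Serre, *Galois Cohomology* I.§2.4, I.§5.8; Gross 1991 §§8–9 (the local conditions at
`λ`); McCallum 1991 §3; Kolyvagin 1989 Izv. §3 (`H¹(ℚ_ℓ)` vs `H¹(K_λ)` at `l = 2`).
-/

-- single-conjunct summit: `Summit.BirchSwinnertonDyer.BirchSwinnertonDyer.…` repeats the name by design
set_option linter.dupNamespace false
set_option autoImplicit false

noncomputable section

universe u

open Literature.NumberTheory.EllipticCurves

namespace Summit.BirchSwinnertonDyer.BirchSwinnertonDyer.Theorems.KolyvaginInfResTwo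

/-! ## §1 The index-two substitute for Sah's lemma -/

section Algebraic

variable {G : Type u} [Group G] {M : Type u} [AddCommGroup M] [DistribMulAction G M]

/-- **Crossed homomorphisms vanishing on an index-two subgroup are principal when the
anti-invariants are coboundaries.** Let `N ≤ G` with `G = N ∪ τN` and `τ² ∈ N`, and let `f : G → M`
be a crossed homomorphism vanishing on `N`. Then `m := f τ` is `N`-invariant with `m + τ•m = 0`
(cocycle identity at `τ·τ ∈ N`), and if `m = τ•x − x` for some `N`-invariant `x` then
`f g = g•x − x` for all `g` (check on the two cosets). This is `H¹(G/N, M^N) = 0` for `G/N ≅ C₂` at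
the cocycle `f`. [cite: SerreGaloisCohomology1997, I.§5.8] -/
theorem exists_eq_smul_sub_of_index_two {N : Subgroup G} [N.Normal] (f : cocyclesVanishingOn M N)
    {τ : G} (hτ2 : τ * τ ∈ N) (hcov : ∀ g : G, g ∈ N ∨ τ⁻¹ * g ∈ N)
    (hsolv : ∀ m : M, (∀ n ∈ N, n • m = m) → m + τ • m = 0 →
      ∃ x : M, (∀ n ∈ N, n • x = x) ∧ τ • x - x = m) :
    ∃ x : M, (∀ n ∈ N, n • x = x) ∧ ∀ g : G, f.1 g = g • x - x := by
  set m : M := f.1 τ with hm_def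
  have hmN : ∀ n ∈ N, n • m = m := fun n hn ↦ cocyclesVanishingOn.smul_apply f τ hn
  have hanti : m + τ • m = 0 := by
    have h := cocyclesVanishingOn.cocycle f τ τ
    rw [cocyclesVanishingOn.apply_of_mem f hτ2] at h
    exact h.symm
  obtain ⟨x, hxN, hx⟩ := hsolv m hmN hanti
  refine ⟨x, hxN, fun g ↦ ?_⟩
  rcases hcov g with hg | hg
  · rw [cocyclesVanishingOn.apply_of_mem f hg, hxN g hg, sub_self]
  · -- `g = τ n` with `n = τ⁻¹ g ∈ N`
    have hgeq : g = τ * (τ⁻¹ * g) := by group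
    rw [hgeq, cocyclesVanishingOn.apply_mul_of_mem f τ hg, mul_smul, hxN _ hg, ← hm_def, hx]

/-- **The regular `C₂`-module is cohomologically trivial in degree one** (solvability form): if
`τ² • e = e`, every `N`-invariant is of the form `a•e + b•τ•e` with `e`, `τ•e` "independent"
(`c•e + c•τ•e = 0 ⟹ c•e = 0`), and `e` is `N`-invariant, then every `N`-invariant `m` with `m + τ•m = 0` is `τ•x − x` for an
`N`-invariant `x` (namely `x = −a•e`). [cite: SerreGaloisCohomology1997, I.§2.4] -/
theorem exists_smul_sub_eq_of_regular {N : Subgroup G} {τ : G} {e : M} (hτe : τ • τ • e = e)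
    (heN : ∀ n ∈ N, n • e = e)
    (hspan : ∀ m : M, (∀ n ∈ N, n • m = m) → ∃ a b : ℤ, m = a • e + b • τ • e)
    (hindep : ∀ c : ℤ, c • e + c • τ • e = 0 → c • e = 0)
    (m : M) (hm : ∀ n ∈ N, n • m = m) (hanti : m + τ • m = 0) :
    ∃ x : M, (∀ n ∈ N, n • x = x) ∧ τ • x - x = m := by
  obtain ⟨a, b, hab⟩ := hspan m hm
  -- `m + τ m = (a + b)•e + (a + b)•τe = 0`, so `(a+b)•e = 0`
  have hsum : (a + b) • e + (a + b) • τ • e = 0 := by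
    have h := hanti
    rw [hab, smul_add, smul_comm τ a e, smul_comm τ b (τ • e), hτe] at h
    rw [← h, add_smul, add_smul]
    abel
  have hab0 : (a + b) • e = 0 := hindep (a + b) hsum
  have hbe : b • e = -(a • e) := by
    rw [add_smul] at hab0
    exact eq_neg_of_add_eq_zero_right hab0
  refine ⟨-(a • e), fun n hn ↦ by rw [smul_neg, smul_comm n a e, heN n hn], ?_⟩
  have h1 : τ • (-(a • e)) = -(a • τ • e) := by rw [smul_neg, smul_comm τ a e]
  have h2 : b • τ • e = -(a • τ • e) := by rw [smul_comm b τ e, hbe, smul_neg, smul_comm τ a e]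
  rw [hab, h1, h2]
  abel

end Algebraic

/-! ## §2 Inflated classes vanish; restriction is injective -/

section Topological

variable {G : Type u} [Group G] [TopologicalSpace G] [IsTopologicalGroup G]
variable {M : Type u} [AddCommGroup M] [DistribMulAction G M] [TopologicalSpace M]
  [DiscreteTopology M]

/-- **Inflated classes from an index-two open normal subgroup vanish** under the solvability
hypothesis of `exists_eq_smul_sub_of_index_two` ("`H¹(G/N, M^N) = 0`", `G/N ≅ C₂`).
[cite: SerreGaloisCohomology1997, I.§5.8] -/
theorem inflClass_eq_zero_of_index_two {N : Subgroup G} [N.Normal] (hN : IsOpen (N : Set G))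
    (f : cocyclesVanishingOn M N) {τ : G} (hτ2 : τ * τ ∈ N) (hcov : ∀ g : G, g ∈ N ∨ τ⁻¹ * g ∈ N)
    (hsolv : ∀ m : M, (∀ n ∈ N, n • m = m) → m + τ • m = 0 →
      ∃ x : M, (∀ n ∈ N, n • x = x) ∧ τ • x - x = m) :
    inflClass M N hN f = 0 := by
  obtain ⟨x, -, hx⟩ := exists_eq_smul_sub_of_index_two f hτ2 hcov hsolv
  rw [inflClass_apply, Literature.NumberTheory.GaloisRepresentations.oneCocycleClass_eq_zero_iff]
  exact ⟨x, fun g ↦ by rw [discreteTopRep_ρ_apply, toContOneCocycle_apply]; exact hx g⟩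

variable {H : Type u} [Group H] [TopologicalSpace H] [IsTopologicalGroup H]
variable {M' : Type u} [AddCommGroup M'] [DistribMulAction H M'] [TopologicalSpace M']
  [DiscreteTopology M']

/-- **Injectivity of restriction across an index-two quotient.** For a compatible pair
`(θ : H → G, ψ : M → M')` with `ψ` bijective and an open normal `N ≤ θ(H)` with `G = N ∪ τN`,
`τ² ∈ N`, and the solvability of `m + τm = 0` by `τ`-coboundaries on `M^N`: the kernel of
`H¹_cont(G, M) → H¹_cont(H, M')` is trivial (it is inflated from `N`, `resKer_le_range_inflClass`,
and inflated classes vanish). Intended use: `G = Γ_{ℚ_ℓ}` (or a decomposition group), `H = Γ_{K_λ}`,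
`M = E[2^M]` at a Kolyvagin prime `ℓ` inert in `K` of depth `M+1` (`Γ_{K_λ}` acts trivially,
`Frob_ℓ` of transposition type: the regular module, `exists_smul_sub_eq_of_regular`).
[cite: SerreGaloisCohomology1997, I.§5.8] [cite: GrossLMS1991, §9 (local conditions at λ)] -/
theorem resKer_eq_bot_of_index_two (θ : H →ₜ* G) (ψ : M →+ M')
    (h : ∀ (x : H) (m : M), ψ (θ x • m) = x • ψ m) (hψ : Function.Bijective ψ)
    (N : Subgroup G) [N.Normal] (hN : IsOpen (N : Set G)) (hNθ : N ≤ (θ : H →* G).range)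
    {τ : G} (hτ2 : τ * τ ∈ N) (hcov : ∀ g : G, g ∈ N ∨ τ⁻¹ * g ∈ N)
    (hsolv : ∀ m : M, (∀ n ∈ N, n • m = m) → m + τ • m = 0 →
      ∃ x : M, (∀ n ∈ N, n • x = x) ∧ τ • x - x = m) :
    resKer θ ψ h = ⊥ := by
  refine eq_bot_iff.2 fun c hc ↦ ?_
  obtain ⟨f, rfl⟩ := resKer_le_range_inflClass θ ψ h hψ N hN hNθ hc
  rw [AddSubgroup.mem_bot]
  exact inflClass_eq_zero_of_index_two hN f hτ2 hcov hsolv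

/-- **Restriction to an index-two open normal subgroup is injective** under the same solvability
hypothesis: `ker (H¹_cont(G, M) → H¹_cont(N, M)) = 0`. [cite: SerreGaloisCohomology1997, I.§5.8] -/
theorem subgroupResKer_eq_bot_of_index_two (N : Subgroup G) [N.Normal] (hN : IsOpen (N : Set G))
    {τ : G} (hτ2 : τ * τ ∈ N) (hcov : ∀ g : G, g ∈ N ∨ τ⁻¹ * g ∈ N)
    (hsolv : ∀ m : M, (∀ n ∈ N, n • m = m) → m + τ • m = 0 →
      ∃ x : M, (∀ n ∈ N, n • x = x) ∧ τ • x - x = m) :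
    subgroupResKer M N = ⊥ :=
  resKer_eq_bot_of_index_two (subgroupIncl N) (AddMonoidHom.id M) (fun _ _ ↦ rfl)
    Function.bijective_id N hN (fun n hn ↦ ⟨⟨n, hn⟩, rfl⟩) hτ2 hcov hsolv

end Topological

end Summit.BirchSwinnertonDyer.BirchSwinnertonDyer.Theorems.KolyvaginInfResTwo

end
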